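import Summits.HodgeConjecture.HodgeConjecture.Theorems.CYFormCasimirCYFormCarrierEightEquivSU
import Literature.AlgebraicGeometry.HodgeTheory.HodgeGroupTwistedHodgeOperators
import HarnessLib

/-!
# Crux X1 `CYFormCarrierEight` (route `CYFormCasimir`, stmt-HodgeConjecture-23493), helper file 17:
# `s₋ s₊ = λ₀ · id` on `⋀⁴W` (`λ₀ ≠ 0`) and `s₋` preserves Hodge types

research route conditional on HC_CM; not a corollary. Nothing here proves HC, HC_CM, the rung H2, X1 or
`stub_cyform_exists`; steps S2/S3 of `Cruxes/CYFormCarrierEight/STUB-PLAN-stub_cyform_exists.md`.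

Consequences of the `SU_H(ℂ)`-equivariance of the duality operators (helper file 16) for a Hodge-general hyperbolic
`ℚ(√-d)`-Weil eightfold (`Hg = SU_H`, Weil classes of type `(4,4)`), `s₊` with datum `0 ≠ v ∈ ⋀⁸W^*`, `s₋` with datum
`0 ≠ v' ∈ ⋀⁸W`:
* `exists_starMinus_starPlus_eq_smul` — **`s₋(s₊ x) = λ₀ x` for all `x ∈ ⋀⁴W`, with ONE non-zero scalar `λ₀`**
  (Friedman–Laza's `⋆⋆ = λ`): in a Weil frame `s₋ s₊` is diagonal (helper file 15); the monomial elements `monoAuto σ c` of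
  `SU_H(ℂ)` permute the `w`-monomials transitively and commute with `s₋ s₊`, so all diagonal entries agree — no value of
  any entry is computed ("sign-free");
* `mem_typePiece_of_hodgeOperator_two` — a class on which the Hodge operator `h_2` acts by the weight `2^{p-q}` is of type
  `(p, q)`;
* `starMinus_mem_typePiece` — **`s₋` maps `⋀⁴W^* ∩ H^{p,q}` into `H^{p,q}`**: the Hodge operators `h_t` lie in the Hodge
  group (`hodgeOperator_mem_hodgeGroup`, Deligne I §3), hence act through `SU_H(ℂ)`, and `s₋` commutes with them.

References: FriedmanLaza2013 (§3.5 Lemma 36), vanGeemen1994HodgeAV (Lemma 6.10, 6.4–6.7, Thm. 6.12), Deligne1982HodgeCycles (I §3).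
-/

-- `Summit.HodgeConjecture.HodgeConjecture.…` is the tree's mandated summit/problem namespace (single-problem summit).
set_option linter.dupNamespace false
noncomputable section

open CategoryTheory
open Literature.AlgebraicTopology.SingularHomology
open Literature.AlgebraicGeometry.Motives
open Literature.AlgebraicGeometry.HodgeTheory
open Literature.AlgebraicGeometry.VanGeemen1994

namespace Summit.HodgeConjecture.HodgeConjecture.Theorems.CYFormCarrier

/-! ## §1 Index transport under block permutations -/

/-- `(σ ⊕ σ)(castAdd(I)) = castAdd(σ I)`: if `σ⁻¹ i ∈ I ↔ i ∈ J` then `permSet (blockPerm σ) castAdd(I) = castAdd(J)`. [folklore] -/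
theorem permSet_blockPerm_map_castAddEmb_eq {k q : ℕ} (σ : Equiv.Perm (Fin k)) (I J : Set.powersetCard (Fin k) q)
    (hσ : ∀ i, σ.symm i ∈ I.val ↔ i ∈ J.val) :
    permSet (blockPerm σ) (Set.powersetCard.map q (Fin.castAddEmb k) I) = Set.powersetCard.map q (Fin.castAddEmb k) J := by
  classical
  apply Subtype.ext
  ext p
  refine Fin.addCases (fun i ↦ ?_) (fun j ↦ ?_) p
  · rw [mem_permSet', blockPerm_symm_castAdd, Set.powersetCard.val_map, Set.powersetCard.val_map,
      CYFormSquare.castAdd_mem_map_castAddEmb_iff, CYFormSquare.castAdd_mem_map_castAddEmb_iff, hσ]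
  · rw [mem_permSet', blockPerm_symm_natAdd, Set.powersetCard.val_map, Set.powersetCard.val_map]
    constructor
    · intro h; exact absurd h CYFormSquare.natAdd_not_mem_map_castAddEmb'
    · intro h; exact absurd h CYFormSquare.natAdd_not_mem_map_castAddEmb'

/-! ## §2 `s₋ s₊ = λ₀ · id` on `⋀⁴W` -/

section Scalar

variable {A : AbelianVariety ℂ} {d : ℕ} {φ : A ⟶ A}
variable (hd : 0 < d) (hA : A.dim = 2 * 4) (hφ : φ ≫ φ = -(d • 𝟙 A))
  (e : ProjectiveEmbedding A.X) {a : complexBetti (projectiveSpace e.n ℂ) 2} (ha : IsRationalClass a)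
  (ha0 : a ≠ 0)

include hd hA hφ e ha ha0 in
/-- **`s₋ s₊ = λ₀ · id` on `⋀⁴W` with `λ₀ ≠ 0`.** For the duality operators `s₊` (datum `0 ≠ v ∈ ⋀⁸W^*`) and `s₋`
(datum `0 ≠ v' ∈ ⋀⁸W`) on a Hodge-general hyperbolic Weil eightfold: in the tree's Weil frame `s₋(s₊ w_I) = λ_I w_I` with
`λ_I ≠ 0` (helper file 15); for two index sets `I, J` a monomial element `u = monoAuto σ c ∈ SU_H(ℂ)` with `σ(I) = J` maps `w_I`
to a non-zero multiple of `w_J` and commutes with `s₋ s₊` (helper file 16), so `λ_I = λ_J`.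
[cite: FriedmanLaza2013, §3.5 Lemma 36] [cite: vanGeemen1994HodgeAV, Lemma 6.10 and proof of Thm. 6.12] -/
theorem exists_starMinus_starPlus_eq_smul (hSU : HasHodgeGroupSU A φ 4 d (hK d φ e a))
    (hW : ∀ c ∈ weilClassesOf A φ 4 d, IsOfHodgeType (2 * 4) A.X (2 * 4) 4 4 c)
    {v : complexBetti A.X (2 * 4)} (hv : v ∈ weilClassesMinus A φ 4 d) (hv0 : v ≠ 0)
    {v' : complexBetti A.X (2 * 4)} (hv' : v' ∈ weilClassesPlus A φ 4 d) (hv0' : v' ≠ 0)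
    (S : complexBetti A.X (2 * 2) →ₗ[ℂ] complexBetti A.X (2 * 2))
    (hS1 : ∀ x ∈ weilClassesPlus A φ 2 d, S x ∈ weilClassesMinus A φ 2 d)
    (hS2 : ∀ x ∈ weilClassesPlus A φ 2 d, ∀ z ∈ weilClassesPlus A φ 2 d,
      topCoord (dim_eq_seven_add_one hA)
          (cupProduct (show 2 * 4 + 2 * 4 = 2 + 2 * 7 from rfl)
            (cupProduct (show 2 * 2 + 2 * 2 = 2 * 4 from rfl) z (S x)) (cupPowTwo (hK d φ e a) 4)) =
        topCoord (dim_eq_seven_add_one hA)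
          (cupProduct (show 2 * 4 + 2 * 4 = 2 + 2 * 7 from rfl)
            (cupProduct (show 2 * 2 + 2 * 2 = 2 * 4 from rfl) z x) v))
    (S' : complexBetti A.X (2 * 2) →ₗ[ℂ] complexBetti A.X (2 * 2))
    (hS'1 : ∀ y ∈ weilClassesMinus A φ 2 d, S' y ∈ weilClassesPlus A φ 2 d)
    (hS'2 : ∀ y ∈ weilClassesMinus A φ 2 d, ∀ z' ∈ weilClassesMinus A φ 2 d,
      topCoord (dim_eq_seven_add_one hA)
          (cupProduct (show 2 * 4 + 2 * 4 = 2 + 2 * 7 from rfl)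
            (cupProduct (show 2 * 2 + 2 * 2 = 2 * 4 from rfl) z' (S' y)) (cupPowTwo (hK d φ e a) 4)) =
        topCoord (dim_eq_seven_add_one hA)
          (cupProduct (show 2 * 4 + 2 * 4 = 2 + 2 * 7 from rfl)
            (cupProduct (show 2 * 2 + 2 * 2 = 2 * 4 from rfl) z' y) v')) :
    ∃ lam : ℂ, lam ≠ 0 ∧ ∀ x ∈ weilClassesPlus A φ 2 d, S' (S x) = lam • x := by
  classical
  have hqk : 2 * 2 + 2 * 2 = Fintype.card (Fin (2 * 4)) := by rw [Fintype.card_fin]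
  set w := wBasis hd hφ hA with hw
  set b := weilBasis (m := 2 * 4 - 1) (k := 2 * 4) (by omega) (by omega) hd hφ e ha ha0 w with hbdef
  have hb : b = weilBasis (m := 2 * 4 - 1) (k := 2 * 4) (by omega) (by omega) hd hφ e ha ha0 w := rfl
  have hvW : v ∈ weilClassesOf A φ 4 d := Submodule.mem_sup_right hv
  have hvW' : v' ∈ weilClassesOf A φ 4 d := Submodule.mem_sup_left hv'
  -- frame vectors and the diagonal entries
  set wP : Set.powersetCard (Fin (2 * 4)) (2 * 2) → complexBetti A.X (2 * 2) :=
    fun I ↦ monB b (2 * 2) (Set.powersetCard.map (2 * 2) (Fin.castAddEmb (2 * 4)) I) with hwP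
  set wM : Set.powersetCard (Fin (2 * 4)) (2 * 2) → complexBetti A.X (2 * 2) :=
    fun K ↦ monB b (2 * 2) (Set.powersetCard.map (2 * 2) (Fin.natAddEmb (2 * 4)) K) with hwM
  set Ic : Set.powersetCard (Fin (2 * 4)) (2 * 2) → Set.powersetCard (Fin (2 * 4)) (2 * 2) :=
    fun I ↦ Set.powersetCard.compl hqk I with hIc
  set cP : Set.powersetCard (Fin (2 * 4)) (2 * 2) → ℂ := fun I ↦
    topCoord (dim_eq_seven_add_one hA)
        (cupProduct (show 2 * 4 + 2 * 4 = 2 + 2 * 7 from rfl)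
          (cupProduct (show 2 * 2 + 2 * 2 = 2 * 4 from rfl) (wP (Ic I)) (wP I)) v) /
      topCoord (dim_eq_seven_add_one hA)
        (cupProduct (show 2 * 4 + 2 * 4 = 2 + 2 * 7 from rfl)
          (cupProduct (show 2 * 2 + 2 * 2 = 2 * 4 from rfl) (wP (Ic I)) (wM (Ic I))) (cupPowTwo (hK d φ e a) 4))
    with hcP
  set cM : Set.powersetCard (Fin (2 * 4)) (2 * 2) → ℂ := fun K ↦
    topCoord (dim_eq_seven_add_one hA)
        (cupProduct (show 2 * 4 + 2 * 4 = 2 + 2 * 7 from rfl)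
          (cupProduct (show 2 * 2 + 2 * 2 = 2 * 4 from rfl) (wM (Ic K)) (wM K)) v') /
      topCoord (dim_eq_seven_add_one hA)
        (cupProduct (show 2 * 4 + 2 * 4 = 2 + 2 * 7 from rfl)
          (cupProduct (show 2 * 2 + 2 * 2 = 2 * 4 from rfl) (wM (Ic K)) (wP (Ic K))) (cupPowTwo (hK d φ e a) 4))
    with hcM
  have hIcIc : ∀ I, Ic (Ic I) = I := fun I ↦ compl_compl_eq hqk I
  have hSP : ∀ I, S (wP I) = cP I • wM (Ic I) := fun I ↦
    starPlus_apply_frame hd hA hφ e ha ha0 w b hb hSU hqk v S hS1 hS2 I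
  have hSM : ∀ K, S' (wM K) = cM K • wP (Ic K) := fun K ↦
    starMinus_apply_frame hd hA hφ e ha ha0 w b hb hSU hqk v' S' hS'1 hS'2 K
  have hD : ∀ I, S' (S (wP I)) = (cP I * cM (Ic I)) • wP I := by
    intro I
    rw [hSP, map_smul, hSM, smul_smul, hIcIc]
  -- non-vanishing of the diagonal
  have hcP0 : ∀ I, cP I ≠ 0 := fun I ↦ div_ne_zero
    (tri_frame_compl_ne_zero hd hA hφ e ha ha0 w b hb hqk I hv hv0)
    (beta_frame_diag_ne_zero hd hA hφ e ha ha0 w b hb hSU (Ic I))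
  have hcM0 : ∀ K, cM K ≠ 0 := fun K ↦ by
    refine div_ne_zero (tri'_frame_compl_ne_zero hd hA hφ e ha ha0 w b hb hqk K hv' hv0') ?_
    rw [cupProduct_comm_four]
    exact beta_frame_diag_ne_zero hd hA hφ e ha ha0 w b hb hSU (Ic K)
  -- all diagonal entries agree
  have hconst : ∀ I J, cP I * cM (Ic I) = cP J * cM (Ic J) := by
    intro I J
    obtain ⟨σ, hσ⟩ := exists_perm_image_eq I.val J.val (by rw [Set.powersetCard.card_eq, Set.powersetCard.card_eq])
    obtain ⟨sg, hsg, hsg2⟩ := exists_unit_sign σ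
    let i₀ : Fin (2 * 4) := ⟨0, by omega⟩
    let c₀ : Fin (2 * 4) → ℂˣ := Function.update (fun _ ↦ 1) i₀ sg
    let cc : Fin (2 * 4 + 2 * 4) → ℂˣ := Fin.append c₀ c₀
    have hcc : ∀ i, cc (Fin.castAdd (2 * 4) i) = c₀ i := fun i ↦ by simp only [cc, Fin.append_left]
    have hcn : ∀ i, cc (Fin.natAdd (2 * 4) i) = c₀ i := fun i ↦ by simp only [cc, Fin.append_right]
    have hprod : ∏ i, (c₀ i : ℂ) = sg := by
      rw [Finset.prod_eq_single i₀]
      · simp only [c₀, Function.update_self]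
      · intro b' _ hb'; simp only [c₀, Function.update_of_ne hb', Units.val_one]
      · intro h; exact absurd (Finset.mem_univ _) h
    set u := monoAuto (m := 2 * 4 - 1) (k := 2 * 4) (by omega) (by omega) hd hφ e ha ha0 w σ cc with hu_def
    have hu : u ∈ weilSpecialUnitaryGroup A φ 4 d (hK d φ e a) := by
      refine monoAuto_mem_weilSpecialUnitaryGroup (m := 2 * 4 - 1) (by omega) (by omega) hd hφ e ha ha0 w
        4 d (by omega) rfl σ cc (fun i ↦ ?_) ?_
      · rw [hcc, hcn]
        by_cases hi : i = i₀
        · subst hi; simp only [c₀, Function.update_self]; exact hsg2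
        · simp only [c₀, Function.update_of_ne hi, Units.val_one, mul_one]
      · simp_rw [hcc]; rw [hprod, ← hsg]; exact hsg2
    -- `⋀⁴u w_I = ε • w_J`
    obtain ⟨ε, hε0, hε⟩ := extAct_monB_of_monomial b (u : complexBetti A.X 1 →ₗ[ℂ] complexBetti A.X 1) (blockPerm σ)
      (fun p ↦ (cc (blockPerm σ p) : ℂ)) (fun _ ↦ Units.ne_zero _)
      (fun p ↦ by rw [LinearEquiv.coe_coe, hu_def, hb, monoAuto_weilBasis]) (2 * 2)
      (Set.powersetCard.map (2 * 2) (Fin.castAddEmb (2 * 4)) I)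
    rw [permSet_blockPerm_map_castAddEmb_eq σ I J hσ] at hε
    change extAct (u : complexBetti A.X 1 →ₗ[ℂ] complexBetti A.X 1) (2 * 2) (wP I) = ε • wP J at hε
    -- equivariance
    have hxP : wP I ∈ weilClassesPlus A φ 2 d := monB_frame_castAdd_mem_weilClassesPlus hd hA hφ e ha ha0 w b hb I
    have h1 := starPlus_extAct_comm hd hA hφ e ha ha0 hSU hW hvW S hS1 hS2 hu hxP
    have h2 := starMinus_extAct_comm hd hA hφ e ha ha0 hSU hW hvW' S' hS'1 hS'2 hu (hS1 _ hxP)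
    have h3 : S' (S (extAct (u : complexBetti A.X 1 →ₗ[ℂ] complexBetti A.X 1) (2 * 2) (wP I))) =
        extAct (u : complexBetti A.X 1 →ₗ[ℂ] complexBetti A.X 1) (2 * 2) (S' (S (wP I))) := by rw [h1, h2]
    rw [hε, map_smul, map_smul, hD J, hD I, map_smul, hε, smul_smul, smul_smul] at h3
    have h4 : (ε * (cP J * cM (Ic J)) - cP I * cM (Ic I) * ε) • wP J = 0 := by rw [sub_smul, h3, sub_self]
    rw [smul_eq_zero] at h4
    rcases h4 with h4 | h4
    · have h5 : ε * (cP J * cM (Ic J) - cP I * cM (Ic I)) = 0 := by linear_combination h4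
      exact (sub_eq_zero.1 ((mul_eq_zero.1 h5).resolve_left hε0)).symm
    · exact absurd h4 ((monB b (2 * 2)).ne_zero _)
  -- conclusion
  set I₀ : Set.powersetCard (Fin (2 * 4)) (2 * 2) :=
    Set.powersetCard.ofCard (s := Finset.univ.filter fun i : Fin (2 * 4) ↦ (i : ℕ) < 2 * 2) (by decide) with hI₀
  refine ⟨cP I₀ * cM (Ic I₀), mul_ne_zero (hcP0 I₀) (hcM0 _), fun x hx ↦ ?_⟩
  have heq : Set.EqOn ⇑(S' ∘ₗ S)
      ⇑((cP I₀ * cM (Ic I₀)) • (LinearMap.id : complexBetti A.X (2 * 2) →ₗ[ℂ] complexBetti A.X (2 * 2))) (Set.range wP) := by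
    rintro _ ⟨I, rfl⟩
    rw [LinearMap.comp_apply, hD I, hconst I I₀, LinearMap.smul_apply, LinearMap.id_apply]
  exact LinearMap.eqOn_span heq (weilClassesPlus_two_le_span_frame hd hA hφ e ha ha0 w b hb hx)

end Scalar

/-! ## §3 Hodge types: classes on which `h_2` acts by a weight -/

section Types

variable {n : ℕ} {X : SchemeOver ℂ}

/-- The Hodge weights `2^{p} 2^{-q}` separate the types on one antidiagonal. [folklore] -/
theorem hodgeWeight_two_injective {k : ℕ} {pq pq' : ↥(Finset.HasAntidiagonal.antidiagonal k)}
    (h : HodgeModel.hodgeWeight (Units.mk0 (2 : ℂ) two_ne_zero) pq = HodgeModel.hodgeWeight (Units.mk0 (2 : ℂ) two_ne_zero) pq') :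
    pq = pq' := by
  obtain ⟨⟨p, q⟩, hpq⟩ := pq
  obtain ⟨⟨p', q'⟩, hpq'⟩ := pq'
  have hs : p + q = k := Finset.HasAntidiagonal.mem_antidiagonal.1 hpq
  have hs' : p' + q' = k := Finset.HasAntidiagonal.mem_antidiagonal.1 hpq'
  simp only [HodgeModel.hodgeWeight, Units.val_inv_eq_inv_val, Units.val_mk0] at h
  -- clear denominators: `2^p 2^{q'} = 2^{p'} 2^q`
  have h2 : (2 : ℂ) ^ p * 2 ^ q' = 2 ^ p' * 2 ^ q := by
    have hq0 : (2 : ℂ) ^ q ≠ 0 := pow_ne_zero _ two_ne_zero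
    have hq0' : (2 : ℂ) ^ q' ≠ 0 := pow_ne_zero _ two_ne_zero
    have h' := h
    simp only [inv_pow] at h'
    rw [← div_eq_mul_inv, ← div_eq_mul_inv, div_eq_div_iff hq0 hq0'] at h'
    exact h'
  rw [← pow_add, ← pow_add] at h2
  have h3 : p + q' = p' + q := by
    have h4 : ((2 ^ (p + q') : ℕ) : ℂ) = ((2 ^ (p' + q) : ℕ) : ℂ) := by push_cast; exact h2
    exact Nat.pow_right_injective (le_refl 2) (Nat.cast_injective h4)
  have hp : p = p' := by omega
  have hq : q = q' := by omega
  subst hp hq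
  rfl

/-- **A class on which the Hodge operator `h_2` acts by the weight of `(p, q)` is of type `(p, q)`**: its other type
components have different weights, hence vanish. [cite: Deligne1982HodgeCycles, I §3] [cite: VoisinHodgeI2002, §7.1.1] -/
theorem mem_typePiece_of_hodgeOperator_two (M : HodgeModel n X) {k : ℕ}
    (pq : ↥(Finset.HasAntidiagonal.antidiagonal k)) {x : complexBetti X k}
    (h : M.hodgeOperator (Units.mk0 (2 : ℂ) two_ne_zero) k x =
      HodgeModel.hodgeWeight (Units.mk0 (2 : ℂ) two_ne_zero) pq • x) :
    x ∈ M.typePiece k pq := by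
  classical
  set t : ℂˣ := Units.mk0 (2 : ℂ) two_ne_zero with ht
  -- the components `(w_{pq'} - w_{pq}) • π_{pq'} x` sum to zero
  have hsum : ∑ pq', (HodgeModel.hodgeWeight t pq' - HodgeModel.hodgeWeight t pq) • M.typeProj k pq' x = 0 := by
    simp_rw [sub_smul]
    rw [Finset.sum_sub_distrib, ← Finset.smul_sum, M.sum_typeProj, ← h, HodgeModel.hodgeOperator, LinearMap.sum_apply]
    simp_rw [LinearMap.smul_apply]
    exact sub_self _
  have hzero : ∀ pq', pq' ≠ pq → M.typeProj k pq' x = 0 := by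
    intro pq' hne
    have hc := M.typeProj_eq_of_sum_eq (y := fun pq' ↦ (HodgeModel.hodgeWeight t pq' - HodgeModel.hodgeWeight t pq) •
      M.typeProj k pq' x) (fun pq' ↦ Submodule.smul_mem _ _ (M.typeProj_mem k pq' x)) hsum pq'
    rw [map_zero] at hc
    have hc' := hc.symm
    rw [smul_eq_zero] at hc'
    rcases hc' with hc' | hc'
    · exact absurd (hodgeWeight_two_injective (sub_eq_zero.1 hc')) hne
    · exact hc'
  have hx : x = M.typeProj k pq x := by
    conv_lhs => rw [← M.sum_typeProj k x]
    rw [Finset.sum_eq_single pq (fun pq' _ hne ↦ hzero pq' hne) (fun h' ↦ absurd (Finset.mem_univ pq) h')]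
  rw [hx]
  exact M.typeProj_mem k pq x

end Types

/-! ## §4 `s₋` preserves Hodge types -/

section StarTypes

variable {A : AbelianVariety ℂ} {d : ℕ} {φ : A ⟶ A}
variable (hd : 0 < d) (hA : A.dim = 2 * 4) (hφ : φ ≫ φ = -(d • 𝟙 A))
  (e : ProjectiveEmbedding A.X) {a : complexBetti (projectiveSpace e.n ℂ) 2} (ha : IsRationalClass a)
  (ha0 : a ≠ 0)

include hd hA hφ e ha ha0 in
/-- **`s₋` preserves Hodge types on `⋀⁴W^*`**: for `y ∈ ⋀⁴W^*` of type `(p, q)`, `s₋ y` is of type `(p, q)`. The Hodge operators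
`h_t` (acting by `tᵖ t^{-q}` on `H^{p,q}`) lie in the Hodge group (Deligne I §3), i.e. in `SU_H(ℂ)` under `Hg = SU_H`, so `s₋`
commutes with them (helper file 16); a class on which `h_2` acts by the weight of `(p, q)` is of type `(p, q)`.
[cite: Deligne1982HodgeCycles, I §3, Prop. 3.4] [cite: FriedmanLaza2013, §3.5 Prop. 37] [cite: vanGeemen1994HodgeAV, 6.4–6.7] -/
theorem starMinus_mem_typePiece (hSU : HasHodgeGroupSU A φ 4 d (hK d φ e a))
    (hW : ∀ c ∈ weilClassesOf A φ 4 d, IsOfHodgeType (2 * 4) A.X (2 * 4) 4 4 c)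
    {v' : complexBetti A.X (2 * 4)} (hv' : v' ∈ weilClassesOf A φ 4 d)
    (S' : complexBetti A.X (2 * 2) →ₗ[ℂ] complexBetti A.X (2 * 2))
    (hS1 : ∀ y ∈ weilClassesMinus A φ 2 d, S' y ∈ weilClassesPlus A φ 2 d)
    (hS2 : ∀ y ∈ weilClassesMinus A φ 2 d, ∀ z' ∈ weilClassesMinus A φ 2 d,
      topCoord (dim_eq_seven_add_one hA)
          (cupProduct (show 2 * 4 + 2 * 4 = 2 + 2 * 7 from rfl)
            (cupProduct (show 2 * 2 + 2 * 2 = 2 * 4 from rfl) z' (S' y)) (cupPowTwo (hK d φ e a) 4)) =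
        topCoord (dim_eq_seven_add_one hA)
          (cupProduct (show 2 * 4 + 2 * 4 = 2 + 2 * 7 from rfl)
            (cupProduct (show 2 * 2 + 2 * 2 = 2 * 4 from rfl) z' y) v'))
    (M : HodgeModel (2 * 4) A.X) (pq : ↥(Finset.HasAntidiagonal.antidiagonal (2 * 2)))
    {y : complexBetti A.X (2 * 2)} (hy : y ∈ weilClassesMinus A φ 2 d) (hyt : y ∈ M.typePiece (2 * 2) pq) :
    S' y ∈ M.typePiece (2 * 2) pq := by
  have hX : IsSmoothProjective (2 * 4) A.X := isSmoothProjective_of_dim_eq' hA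
  set t : ℂˣ := Units.mk0 (2 : ℂ) two_ne_zero with ht
  set g : ∀ k : ℕ, complexBetti A.X k ≃ₗ[ℂ] complexBetti A.X k := fun k ↦ M.twistedHodgeOperator (RingEquiv.refl ℂ) t k
    with hg_def
  have hg : g ∈ hodgeGroup A.dim A.X := by rw [hA]; exact M.hodgeOperator_mem_hodgeGroup hX t
  have hu1 : g 1 ∈ hodgeGroupOne A.dim A.X := mem_hodgeGroupOne_iff.2 ⟨g, hg, rfl⟩
  have hu : g 1 ∈ weilSpecialUnitaryGroup A φ 4 d (hK d φ e a) := by rw [← hSU]; exact hu1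
  -- `h_t` on `H⁴` is the exterior action of `g 1`
  have hgt : ∀ c : complexBetti A.X (2 * 2),
      extAct ((g 1 : complexBetti A.X 1 ≃ₗ[ℂ] complexBetti A.X 1) : complexBetti A.X 1 →ₗ[ℂ] complexBetti A.X 1) (2 * 2) c =
        M.hodgeOperator t (2 * 2) c := by
    intro c
    rw [← hodgeGroup_apply_eq_extAct hg (2 * 2) c]
    exact M.twistedHodgeOperator_refl t (2 * 2) c
  have hcomm := starMinus_extAct_comm hd hA hφ e ha ha0 hSU hW hv' S' hS1 hS2 hu hy
  rw [hgt, hgt, M.hodgeOperator_apply_of_mem t hyt, map_smul] at hcomm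
  exact mem_typePiece_of_hodgeOperator_two M pq hcomm.symm

end StarTypes

end Summit.HodgeConjecture.HodgeConjecture.Theorems.CYFormCarrier

end
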